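import Summits.HodgeConjecture.HodgeConjecture.Theses.AffinePartDecay

/-!
# Route AffinePartDecay — `SummitImpliesTarget` (support item stmt-HodgeConjecture-1971)

`HodgeConjecture → AffineComplementPrinciple`: granted the Hodge conjecture every rational
`(p, p)`-class is algebraic, hence lies in `algebraicClasses X p ⊔ ker (restriction to X ∖ H)` for
every closed `H` (with affine complement or not).  Pure logic over the route file; no other import,
no named-fact hypothesis, no sorry.
-/

-- `Summit.HodgeConjecture.HodgeConjecture.Theorems` is the mandated namespace (single-problem
-- summit: Problem = Summit), which `linter.dupNamespace` flags on every declaration; the lakefile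
-- turns the linter off tree-wide (weak option), restated here so stand-alone elaboration is
-- warning-free too.
set_option linter.dupNamespace false

namespace Summit.HodgeConjecture.HodgeConjecture.Theorems

/-- **Item stmt-HodgeConjecture-1971 (`SummitImpliesTarget`), route `AffinePartDecay`**: the Hodge
conjecture gives `c ∈ algebraicClasses X p`, the left summand of the target's conclusion.
[cite: Deligne2000, §1] -/
theorem affinePartDecay_summitImpliesTarget_proof :
    Summit.HodgeConjecture.HodgeConjecture.Theses.AffinePartDecay.SummitImpliesTarget :=
  fun hHC _n _X hX _H _hH _hU p c hc hpp ↦ Submodule.mem_sup_left ((hHC hX).2 p c hc hpp)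

end Summit.HodgeConjecture.HodgeConjecture.Theorems
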